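import Mathlib.Analysis.SpecialFunctions.SmoothTransition
import Mathlib.Analysis.InnerProductSpace.Calculus
import Literature.Analysis.FluidPDE.NSFiniteEnergySmooth
import Literature.Analysis.FluidPDE.SpaceTimeCalculus
import HarnessLib

/-!
# Tao (2011/2013), Lemma 8.1 (global energy inequality for smooth finite-energy solutions):
# decomposition along the printed proof — layer 1, energy localisation
# (family `ns`, topic `Literature/Analysis/FluidPDE`)

Sibling of `NSFiniteEnergySmooth.lean`, whose named fact
`NS.tao_finite_energy_smooth_energy_bound` is Tao's **Lemma 8.1** (arXiv:1108.1165, §8, "Lemma 44"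
in the arXiv text rendering, pp. 24–25; Anal. PDE 6 (2013), p. 43): for a finite energy smooth
solution of Navier–Stokes on `[0, T] × ℝ³`,
`‖u‖_{L^∞_t L²_x} + ‖∇u‖_{L²_t L²_x} ≲ E(u₀, f, T)^{1/2}` — the dissipation `∇u ∈ L²_t L²_x` being
*not* assumed. The fact is an XL discharge (its printed proof uses the pressure normalisation of
Lemma 4.1 (i), the `L²` boundedness of the second Riesz transforms `Δ⁻¹∂ᵢ∂ⱼ`, a commutator
estimate, the Gagliardo–Nirenberg–Sobolev inequality and a localised energy identity), so,
following the tree's decomposition protocol (cf. `NormalisedPressureProofs`,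
`TaoEnstrophyLocalisation`), this file vendors the hinge of the printed proof as ONE named fact
and **proves** Lemma 8.1 from it.

## The printed proof (Tao 2011, §8, proof of Lemma 8.1, (54)–(65))

With `A := ‖u‖_{L^∞_t L²_x}` ((56): `‖u(t)‖_{L²} ≤ A` for all `t`, here the finite-energy
hypothesis itself) and a smooth cutoff `η` with `η⁴ = 1` on `B(0, R - r)`, `supp η⁴ ⊆ B(0, R)`,
`∇ʲη = O(r⁻ʲ)` ((58)), `0 < r < R/2`, the localised energy `E_{η⁴}(t) = ½ ∫ |u|² η⁴` ((59)) is
`C¹` in `t` and ((61)) `∂ₜ E_{η⁴} = -X₁ + X₂ + X₃ + X₄ + X₅` (dissipation `X₁ = ‖η²∇u‖²_{L²}` (62),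
heat flux, transport, forcing (`= 0` here) and pressure terms, the latter with the normalised
pressure `p̃ = -Δ⁻¹∂ᵢ∂ⱼ(uᵢuⱼ)`, (54)–(55), valid for a.e. `t` by Lemma 4.1 (i)); Hölder, Sobolev
and singular-integral bounds give ((65)) `∂ₜ E_{η⁴} + X₁ ≲ A²/r² + A⁶/r⁴` (for `f = 0`), whence by
the fundamental theorem of calculus `E_{η⁴}(t) ≲ E + (A²/r² + A⁶/r⁴) T` and
`∫₀ᵀ X₁ ≲ (A²/r² + A⁶/r⁴) T + E`; "sending `r, R → ∞` and using the monotone convergence theorem"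
gives the lemma.

## Contents

* `NS.taoCutoff R r` — the cutoff `θ_{R,r}(x) = χ((R² - |x|²)/(rR))`, `χ = Real.smoothTransition`
  (`= 1` on `B(0, R - r)`, `= 0` off `B(0, R)`, `∇ʲθ = O(r⁻ʲ)` for `r < R/2`: the properties (58);
  Tao's `η` is `θ²`, his weight `η⁴` is `θ⁸`), with its elementary API (values in `[0, 1]`,
  smoothness, support, the monotone exhausting family `θ_{c, c/4} ↑ 1`).
* `NS.localisedEnergy φ v = ½ ∫ φ |v|²` ((59)) and `NS.localisedDissipation φ v = ∫ φ |∇v|²` ((62),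
  density `Fluid.frobeniusNormSq (fderiv ℝ v x)` as in the target fact).
* `NS.tao2011_localisedEnergyInequality` — **named fact** (nothing asserted): (65) integrated in
  time, homogeneous case, viscosity `ν > 0`, in the honest form
  `E_{θ⁸}(u(t)) + (ν/2) ∫₀ᵗ X₁ ≤ E_{θ⁸}(u(0)) + C (ν A²/r² + A⁶/(ν³ r⁴)) t` for `t ∈ [0, T]`,
  `0 < r < R/2`, `C` absolute. [cite: Tao2011, §8, proof of Lemma 8.1, (65)]
* `NS.tao_finite_energy_smooth_energy_bound_of_localisedEnergyInequality` — **proved assembly**: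
  the fact implies `NS.tao_finite_energy_smooth_energy_bound` (with constant `1`, i.e. the energy
  inequality `‖u(t)‖²_{L²} ≤ ‖u₀‖²_{L²}`, `ν ∫₀ᵀ‖∇u‖²_{L²} ≤ ‖u₀‖²_{L²}`): `R = n + 1`, `r = R/4`,
  dominated convergence for `E_{θ_n⁸}(u(t)) → ½‖u(t)‖²`, monotone convergence (twice: in `x` and
  in `t`) for the space–time dissipation.

## Design

* **No rescaling.** Tao normalises `ν = 1` (footnote 3); the estimates behind (65) are homogeneous
  and we state the fact directly for `ν > 0` (`∂ₜE + (ν/2)X₁ ≤ C(νA²/r² + A⁶/(ν³r⁴))`, the two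
  monomials being the `ν`-consistent forms of Tao's `A²/r²`, `A⁶/r⁴`; the intermediate terms
  `A³/r^{5/2}`, `A⁴/(νr³)` are absorbed into them by the weighted AM–GM inequality exactly as in
  print).
* **The next layers** (sibling `TaoEnergyLocalisationProofs`, in progress): the fact is to be
  proved from (61) (differentiation under the integral sign and whole-space integration by parts,
  tree `SpaceTimeCalculus`/`WholeSpaceIBP`), the bounds of `X₂`, `X₃` (Mathlib's
  Gagliardo–Nirenberg–Sobolev inequality `MeasureTheory.eLpNorm_le_eLpNorm_fderiv_of_eq`), the
  pressure normalisation `NS.tao_pressure_normalisation` (Lemma 4.1 (i), tree, named fact) and a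
  named fact for the pressure term `X₅` resting on the `L²` bound for `p̃` (Stein 1970, III §1) and
  the existence of the principal values (`NS.hasPressurePV_of_contDiff`, tree). The commutator step
  for `X₅,₂` as printed in the arXiv version ("`[Δ⁻¹∇², η³]` is a smoothing operator of infinite
  order … `‖[Δ⁻¹∇², η³]f‖_{L²} ≲ r^{-3/2}‖f‖_{L¹}`") does not hold for general `f ∈ L¹` (the
  commutator of the order-`0` operator `Δ⁻¹∇²` with a smooth multiplier has kernel
  `≍ r⁻¹|x - y|⁻²` near the diagonal, not square integrable in `ℝ³`); splitting that kernel at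
  `|x - y| = r` and pairing `|u|² ∈ L¹`, `θ⁴u ∈ L⁶` (Sobolev) instead yields
  `X₅,₂ ≲ A^{3/2} r⁻¹ ‖∇(θ⁴u)‖^{3/2}_{L²} + A² r^{-3/2} ‖∇(θ⁴u)‖_{L²} + A³ r^{-5/2}`, which after
  Young's inequality is again `≤ ½·(ν/2) X₁ + C(νA²/r² + A⁶/(ν³r⁴))`; so (65), the fact below and
  Lemma 8.1 are unaffected.

## Mathlib / tree search

`Real.smoothTransition` (used: `zero_of_nonpos`, `one_of_one_le`, `monotone`, `contDiff`),
`contDiff_norm_sq`, `MeasureTheory.tendsto_integral_of_dominated_convergence`, `lintegral_iSup'`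
(used); tree: `Fluid.IsClassicalNSSolutionOn`, `Fluid.frobeniusNormSq`,
`Fluid.continuousOn_integral_of_support_subset`, `Fluid.IsSmoothSpaceTimeOn.continuousOn_fderiv_slice`
(used); `lean search 'localisedEnergy|taoCutoff|energy_bound'`: no prior decl; the tree's
`Fluid.cutoff R` (`WholeSpaceIBP`, `= 1` on `B_R`, `0` off `B_{2R}`) has the wrong geometry for
(58) (transition layer of width `r` *inside* `B(0, R)`), hence `taoCutoff`.

## References

* T. Tao, *Localisation and compactness properties of the Navier–Stokes global regularity
  problem*, Anal. PDE 6 (2013) 25–107 = arXiv:1108.1165 (`Tao2011`): §8, Lemma 8.1 and its proof,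
  (53)–(65) (arXiv pp. 24–25, "Lemma 44"); Lemma 4.1 (i) (§4); footnote 3 (viscosity).
* E. M. Stein, *Singular integrals and differentiability properties of functions* (1970), Ch. II
  §4, Ch. III §1 (Riesz transforms).
-/

noncomputable section

open MeasureTheory Set Filter Topology Function Metric
open scoped ENNReal NNReal RealInnerProductSpace ContDiff

namespace Literature.Analysis.FluidPDE

/-! ## Tao's spatial cutoff -/

section Cutoff

variable {E : Type*} [NormedAddCommGroup E]

/-- **Tao's cutoff** adapted to the balls `B(0, R - r) ⊂ B(0, R)`: the smooth function
`θ_{R,r}(x) = χ((R² - |x|²)/(rR))` with `χ = Real.smoothTransition` (`= 0` on `(-∞, 0]`, `= 1` on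
`[1, ∞)`, monotone, values in `[0, 1]`). For `0 < r < R` it equals `1` on `B(0, R - r)`
(`taoCutoff_eq_one_of_norm_le`), vanishes off `B(0, R)` (`taoCutoff_eq_zero`), and its `j`-th
derivatives are `O(r^{-j})` when `r < R/2` — the three properties (58) that Tao's
`η(x) = χ((|x| - R)/r)` is introduced for (Tao 2011, §8, proof of Lemma 8.1, before (58)); we
compose with the polynomial `R² - |x|²` rather than with `|x| - R` so that smoothness and the
derivative bounds are elementary, and we use `θ²` in the role of Tao's `η` (so that
`η^{3/2} = θ³` is manifestly smooth; Tao's weight `η⁴` is `θ⁸`). Junk: for `r = 0` or `R = 0`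
the function is identically `0` (`x / 0 = 0`). [cite: Tao2011, §8, proof of Lemma 8.1, (58)] -/
def taoCutoff (R r : ℝ) (x : E) : ℝ :=
  Real.smoothTransition ((R ^ 2 - ‖x‖ ^ 2) / (r * R))

variable {R r : ℝ} {x : E}

/-- Unfolding `taoCutoff`. [folklore] -/
theorem taoCutoff_apply (R r : ℝ) (x : E) :
    taoCutoff R r x = Real.smoothTransition ((R ^ 2 - ‖x‖ ^ 2) / (r * R)) := rfl

/-- `0 ≤ θ`. [folklore] -/
theorem taoCutoff_nonneg (R r : ℝ) (x : E) : 0 ≤ taoCutoff R r x :=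
  Real.smoothTransition.nonneg _

/-- `θ ≤ 1`. [folklore] -/
theorem taoCutoff_le_one (R r : ℝ) (x : E) : taoCutoff R r x ≤ 1 :=
  Real.smoothTransition.le_one _

/-- `0 ≤ θ ^ n`. [folklore] -/
theorem taoCutoff_pow_nonneg (R r : ℝ) (x : E) (n : ℕ) : 0 ≤ taoCutoff R r x ^ n :=
  pow_nonneg (taoCutoff_nonneg R r x) n

/-- `θ ^ n ≤ 1`. [folklore] -/
theorem taoCutoff_pow_le_one (R r : ℝ) (x : E) (n : ℕ) : taoCutoff R r x ^ n ≤ 1 :=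
  pow_le_one₀ (taoCutoff_nonneg R r x) (taoCutoff_le_one R r x)

/-- `θ` is continuous. [folklore] -/
theorem continuous_taoCutoff (R r : ℝ) : Continuous (taoCutoff (E := E) R r) :=
  Real.smoothTransition.continuous.comp (by fun_prop)

/-- `θ_{R,r}(x) = 0` for `|x| ≥ R` (`0 ≤ r`, `0 ≤ R`): the cutoff is supported in the closed ball
`B̄(0, R)` (Tao: "`η⁴` is supported on the ball `B(0,R)`"). [cite: Tao2011, §8, proof of Lemma 8.1, (58)] -/
theorem taoCutoff_eq_zero (hR : 0 ≤ R) (hr : 0 ≤ r) (hx : R ≤ ‖x‖) : taoCutoff R r x = 0 := by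
  apply Real.smoothTransition.zero_of_nonpos
  apply div_nonpos_of_nonpos_of_nonneg
  · nlinarith [norm_nonneg x]
  · positivity

/-- `θ_{R,r}(x) = 1` as soon as `|x|² ≤ R (R - r)` (`0 < r`, `0 < R`). [folklore] -/
theorem taoCutoff_eq_one (hR : 0 < R) (hr : 0 < r) (hx : ‖x‖ ^ 2 ≤ R * (R - r)) :
    taoCutoff R r x = 1 := by
  apply Real.smoothTransition.one_of_one_le
  rw [le_div_iff₀ (mul_pos hr hR)]
  nlinarith

/-- `θ_{R,r} = 1` on the closed ball `B̄(0, R - r)` for `0 < r ≤ R` (Tao: "and equals `1` on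
`B(0, R - r)`"). [cite: Tao2011, §8, proof of Lemma 8.1, (58)] -/
theorem taoCutoff_eq_one_of_norm_le (hR : 0 < R) (hr : 0 < r) (hrR : r ≤ R) (hx : ‖x‖ ≤ R - r) :
    taoCutoff R r x = 1 := by
  apply taoCutoff_eq_one hR hr
  have h0 : 0 ≤ R - r := sub_nonneg.2 hrR
  calc ‖x‖ ^ 2 ≤ (R - r) ^ 2 := pow_le_pow_left₀ (norm_nonneg x) hx 2
    _ ≤ R * (R - r) := by nlinarith

/-- The support of `θ_{R,r}` lies in the closed ball `B̄(0, R)` (`0 ≤ r`, `0 ≤ R`). [folklore] -/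
theorem support_taoCutoff_subset (hR : 0 ≤ R) (hr : 0 ≤ r) :
    support (taoCutoff (E := E) R r) ⊆ closedBall (0 : E) R := by
  intro x hx
  rw [mem_closedBall_zero_iff]
  by_contra h
  exact hx (taoCutoff_eq_zero hR hr (not_le.1 h).le)

/-- The support of `θ_{R,r} ^ n`, `n ≠ 0`, lies in the closed ball `B̄(0, R)`. [folklore] -/
theorem support_taoCutoff_pow_subset (hR : 0 ≤ R) (hr : 0 ≤ r) {n : ℕ} (hn : n ≠ 0) :
    support (fun x : E => taoCutoff R r x ^ n) ⊆ closedBall (0 : E) R := by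
  intro x hx
  apply support_taoCutoff_subset hR hr
  intro h
  apply hx
  simp [h, hn]

/-- The one-parameter family used in the limit `R → ∞` (with `r = R/4 < R/2`):
`θ_{c, c/4}(x) = χ(4 - 4|x|²/c²)`. [folklore] -/
theorem taoCutoff_quarter_apply {c : ℝ} (hc : c ≠ 0) (x : E) :
    taoCutoff c (c / 4) x = Real.smoothTransition (4 - 4 * ‖x‖ ^ 2 / c ^ 2) := by
  rw [taoCutoff_apply]
  congr 1
  field_simp

/-- Along `c ↦ θ_{c, c/4}(x)` the cutoffs increase (`c > 0`). [folklore] -/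
theorem taoCutoff_quarter_mono (x : E) {c c' : ℝ} (hc : 0 < c) (hcc' : c ≤ c') :
    taoCutoff c (c / 4) x ≤ taoCutoff c' (c' / 4) x := by
  rw [taoCutoff_quarter_apply hc.ne' x, taoCutoff_quarter_apply (hc.trans_le hcc').ne' x]
  apply Real.smoothTransition.monotone
  have h1 : 4 * ‖x‖ ^ 2 / c' ^ 2 ≤ 4 * ‖x‖ ^ 2 / c ^ 2 :=
    div_le_div_of_nonneg_left (by positivity) (pow_pos hc 2) (pow_le_pow_left₀ hc.le hcc' 2)
  linarith

/-- Along `c ↦ θ_{c, c/4}(x)` the cutoffs are eventually equal to `1` (as soon as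
`|x|² ≤ 3c²/4`). [folklore] -/
theorem taoCutoff_quarter_eq_one (x : E) {c : ℝ} (hc : 0 < c) (hx : ‖x‖ ≤ c / 2) :
    taoCutoff c (c / 4) x = 1 := by
  apply taoCutoff_eq_one hc (by positivity)
  have : ‖x‖ ^ 2 ≤ (c / 2) ^ 2 := pow_le_pow_left₀ (norm_nonneg x) hx 2
  nlinarith

section Smooth

variable [InnerProductSpace ℝ E]

/-- `θ` is smooth (composition of `Real.smoothTransition` with the polynomial `R² - |x|²`, the
norm coming from an inner product). [folklore] -/
theorem contDiff_taoCutoff {n : ℕ∞} (R r : ℝ) : ContDiff ℝ n (taoCutoff (E := E) R r) :=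
  Real.smoothTransition.contDiff.comp
    ((contDiff_const.sub (contDiff_norm_sq ℝ)).div_const (r * R))

/-- The powers `θ ^ m` are smooth. [folklore] -/
theorem contDiff_taoCutoff_pow {n : ℕ∞} (R r : ℝ) (m : ℕ) :
    ContDiff ℝ n (fun x : E => taoCutoff R r x ^ m) :=
  (contDiff_taoCutoff R r).pow m

variable [FiniteDimensional ℝ E]

/-- `θ_{R,r}` has compact support (`0 ≤ r`, `0 ≤ R`; finite dimension). [folklore] -/
theorem hasCompactSupport_taoCutoff (hR : 0 ≤ R) (hr : 0 ≤ r) :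
    HasCompactSupport (taoCutoff (E := E) R r) :=
  HasCompactSupport.of_support_subset_isCompact (isCompact_closedBall 0 R)
    (support_taoCutoff_subset hR hr)

/-- `θ_{R,r} ^ n`, `n ≠ 0`, has compact support. [folklore] -/
theorem hasCompactSupport_taoCutoff_pow (hR : 0 ≤ R) (hr : 0 ≤ r) {n : ℕ} (hn : n ≠ 0) :
    HasCompactSupport (fun x : E => taoCutoff R r x ^ n) :=
  HasCompactSupport.of_support_subset_isCompact (isCompact_closedBall 0 R)
    (support_taoCutoff_pow_subset hR hr hn)

end Smooth

end Cutoff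

/-! ## Localised energy and dissipation -/

section Localised

variable {E : Type*} [NormedAddCommGroup E] [InnerProductSpace ℝ E] [FiniteDimensional ℝ E]
  [MeasurableSpace E] [BorelSpace E]

/-- The **localised energy** `E_φ(v) = ½ ∫ φ(x) |v(x)|² dx` of a velocity slice `v` against a
weight `φ` (Tao 2011, (59): `E_{η⁴}(t) = ∫ ½ |u|²(t,x) η⁴(x) dx`, i.e. `φ = η⁴`). Bochner
integral (junk `0` if not integrable; never the case for continuous `v` and compactly supported
continuous `φ`). [cite: Tao2011, §8, (59)] -/
def localisedEnergy (φ : E → ℝ) (v : E → E) : ℝ :=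
  2⁻¹ * ∫ x, φ x * ‖v x‖ ^ 2

/-- The **localised dissipation** `X₁ = ∫ φ(x) |∇v(x)|² dx` (Tao 2011, (62):
`X₁ = ∫ |∇u|² η⁴ dx = ‖η² ∇u‖²_{L²}`, `φ = η⁴`), with the tree's dissipation density
`Fluid.frobeniusNormSq (fderiv ℝ v x) = |∇v(x)|²`. [cite: Tao2011, §8, (62)] -/
def localisedDissipation (φ : E → ℝ) (v : E → E) : ℝ :=
  ∫ x, φ x * FluidPDE.frobeniusNormSq (fderiv ℝ v x)

/-- Unfolding `localisedEnergy`. [folklore] -/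
theorem localisedEnergy_def (φ : E → ℝ) (v : E → E) :
    localisedEnergy φ v = 2⁻¹ * ∫ x, φ x * ‖v x‖ ^ 2 := rfl

/-- Unfolding `localisedDissipation`. [folklore] -/
theorem localisedDissipation_def (φ : E → ℝ) (v : E → E) :
    localisedDissipation φ v = ∫ x, φ x * FluidPDE.frobeniusNormSq (fderiv ℝ v x) := rfl

/-- The localised energy is nonnegative for a nonnegative weight. [folklore] -/
theorem localisedEnergy_nonneg {φ : E → ℝ} (hφ : ∀ x, 0 ≤ φ x) (v : E → E) :
    0 ≤ localisedEnergy φ v :=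
  mul_nonneg (by norm_num) (integral_nonneg fun x => mul_nonneg (hφ x) (sq_nonneg _))

/-- The localised dissipation is nonnegative for a nonnegative weight. [folklore] -/
theorem localisedDissipation_nonneg {φ : E → ℝ} (hφ : ∀ x, 0 ≤ φ x) (v : E → E) :
    0 ≤ localisedDissipation φ v :=
  integral_nonneg fun x => mul_nonneg (hφ x) (FluidPDE.frobeniusNormSq_nonneg _)

/-- With the weight `1` the localised energy is the kinetic energy `½ ∫ |v|²`. [folklore] -/
theorem localisedEnergy_one (v : E → E) :
    localisedEnergy (fun _ => (1 : ℝ)) v = VectorCalculus.kineticEnergy v := by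
  simp [localisedEnergy, VectorCalculus.kineticEnergy]

/-- For weights `0 ≤ φ ≤ 1` and `|v|² ∈ L¹`, `E_φ(v) ≤ ½ ∫ |v|²` (Tao 2011, (60):
`E_{η⁴}(0) ≲ E(u₀, f)`). [cite: Tao2011, §8, (60)] -/
theorem localisedEnergy_le_of_le_one {φ : E → ℝ} (hφ0 : ∀ x, 0 ≤ φ x) (hφ1 : ∀ x, φ x ≤ 1)
    {v : E → E} (hv : Integrable (fun x => ‖v x‖ ^ 2)) :
    localisedEnergy φ v ≤ 2⁻¹ * ∫ x, ‖v x‖ ^ 2 := by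
  unfold localisedEnergy
  refine mul_le_mul_of_nonneg_left ?_ (by norm_num)
  refine integral_mono_of_nonneg (Eventually.of_forall fun x => mul_nonneg (hφ0 x) (sq_nonneg _))
    hv (Eventually.of_forall fun x => ?_)
  calc φ x * ‖v x‖ ^ 2 ≤ 1 * ‖v x‖ ^ 2 := by gcongr; exact hφ1 x
    _ = ‖v x‖ ^ 2 := one_mul _

end Localised

end Literature.Analysis.FluidPDE

namespace Literature.Analysis.FluidPDE

/-- Local notation for physical space `ℝ³ = EuclideanSpace ℝ (Fin 3)`. -/
local notation "ℝ³" => EuclideanSpace ℝ (Fin 3)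

/-! ## The named fact: Tao's localised energy inequality ((65) integrated in time) -/

/-- **Tao 2011, §8, proof of Lemma 8.1: the localised energy inequality (65) ("pater"),
integrated in time; homogeneous case `f = 0`, viscosity `ν > 0`.** Printed (with `ν = 1` and a
forcing term): for a finite energy almost smooth solution with `‖u(t)‖_{L²} ≤ A` on `[0, T]`
((56)) and the cutoff `η⁴` adapted to `B(0, R - r) ⊂ B(0, R)`, `0 < r < R/2`, one has for almost
every `t` the differential inequality (65)
`∂ₜ E_{η⁴} + X₁ ≲ A²/r² + A⁶/r⁴ + E_{η⁴}^{1/2} a(t)`, `X₁ = ‖η²∇u‖²_{L²}`, whence "by the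
fundamental theorem of calculus" bounds for `E_{η⁴}(t)` and `∫₀ᵀ X₁ dt` in terms of `E_{η⁴}(0)`
and `(A²/r² + A⁶/r⁴) T`. Rendering: `f = 0` (so `a = 0` and (65) integrates literally); the
solution is a classical solution on the closed slab `[0, T] × ℝ³`
(`Fluid.IsClassicalNSSolutionOn (Icc 0 T) ν 0 u p`, a subclass of Tao's almost smooth class);
Tao's `η` is `θ²` with `θ = taoCutoff R r` (so `η⁴ = θ⁸`, same properties (58)); the absorbed
half of the dissipation is kept on the left (`½ X₁`, the honest form of "`∂ₜE + X₁ ≲ …`" after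
Young's inequality); and the viscosity is restored by dimensional analysis / the rescaling
`v(s, y) = ν⁻¹ u(s/ν, y)` of footnote 3: `∂ₜ E_{θ⁸} + (ν/2) X₁ ≤ C (ν A²/r² + A⁶/(ν³ r⁴))`.
The implied constant `C` is absolute. (The estimate of the commutator term `X₅,₂` printed in the
arXiv version, `‖[Δ⁻¹∇², η³] g‖_{L²} ≲ r^{-3/2} ‖g‖_{L¹}`, is not correct as stated — the commutator
kernel is `≍ r⁻¹ |x - y|⁻²` near the diagonal, which is not square integrable in `ℝ³` —; the term is
controlled instead by splitting the kernel at `|x - y| = r`, which produces the same right-hand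
side after Young's inequality, so (65) and this statement are unaffected. Details in the sibling
`TaoEnergyLocalisationProofs`.) Nothing asserted; the assembly
`tao_finite_energy_smooth_energy_bound_of_localisedEnergyInequality` derives Lemma 8.1 from it.
[cite: Tao2011, §8, proof of Lemma 8.1, (65)] -/
def tao2011_localisedEnergyInequality : Prop :=
  ∃ C : ℝ, 0 ≤ C ∧ ∀ (ν T : ℝ), 0 < ν → 0 < T →
    ∀ (u : ℝ → ℝ³ → ℝ³) (p : ℝ → ℝ³ → ℝ), FluidPDE.IsClassicalNSSolutionOn (Icc 0 T) ν 0 u p →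
    ∀ A : ℝ, 0 ≤ A → (∀ t ∈ Icc 0 T, ∫⁻ x, ‖u t x‖ₑ ^ 2 ≤ ENNReal.ofReal (A ^ 2)) →
    ∀ (R r : ℝ), 0 < r → 2 * r < R → ∀ t ∈ Icc 0 T,
      localisedEnergy (fun x => taoCutoff R r x ^ 8) (u t) +
          ν / 2 * ∫ s in Ioo 0 t, localisedDissipation (fun x => taoCutoff R r x ^ 8) (u s) ≤
        localisedEnergy (fun x => taoCutoff R r x ^ 8) (u 0) +
          C * (ν * A ^ 2 / r ^ 2 + A ^ 6 / (ν ^ 3 * r ^ 4)) * t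

/-! ## Assembly: Lemma 8.1 from the localised energy inequality

"Sending `r, R → ∞` and using the monotone convergence theorem we conclude
`‖u‖_{L^∞_t L²_x} ≲ E^{1/2}` … inserting this back into (65) and integrating …
`‖∇u‖_{L²_t L²_x} ≲ E^{1/2}`" (Tao 2011, end of the proof of Lemma 8.1). We take `R = n + 1`,
`r = R/4`. -/

section Assembly

/-- The Frobenius norm squared is a continuous function of the linear map. [folklore] -/
theorem continuous_frobeniusNormSq_clm :
    Continuous fun L : ℝ³ →L[ℝ] ℝ³ => FluidPDE.frobeniusNormSq L := by
  unfold FluidPDE.frobeniusNormSq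
  exact continuous_finsetSum _ fun i _ =>
    ((continuous_id.clm_apply continuous_const).norm).pow 2

/-- A continuous field with `∫⁻ ‖v‖ₑ² < ∞` has integrable `‖v‖²`. [folklore] -/
theorem integrable_sq_of_lintegral_enorm_sq_lt_top {v : ℝ³ → ℝ³} (hv : Continuous v)
    (h : ∫⁻ x, ‖v x‖ₑ ^ 2 < ⊤) : Integrable fun x => ‖v x‖ ^ 2 := by
  refine ⟨(hv.norm.pow 2).aestronglyMeasurable, ?_⟩
  refine (hasFiniteIntegral_iff_enorm).2 (lt_of_le_of_lt (le_of_eq ?_) h)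
  refine lintegral_congr fun x => ?_
  rw [Real.enorm_eq_ofReal (sq_nonneg _), ← ofReal_norm, ENNReal.ofReal_pow (norm_nonneg _)]

/-- `ofReal (∫ ‖v‖²) = ∫⁻ ‖v‖ₑ²` for integrable `‖v‖²`. [folklore] -/
theorem ofReal_integral_norm_sq_eq_lintegral {v : ℝ³ → ℝ³} (hv : Integrable fun x => ‖v x‖ ^ 2) :
    ENNReal.ofReal (∫ x, ‖v x‖ ^ 2) = ∫⁻ x, ‖v x‖ₑ ^ 2 := by
  rw [ofReal_integral_eq_lintegral_ofReal hv (ae_of_all _ fun x => sq_nonneg _)]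
  exact lintegral_congr fun x => by rw [← ofReal_norm, ENNReal.ofReal_pow (norm_nonneg _)]

/-- Continuity in time of the localised dissipation `t ↦ ∫ φ |∇u(t)|²` on the closed slab, for a
jointly smooth velocity and a continuous compactly supported weight ("`E_{η⁴}` is `C¹_t` … we may
differentiate under the integral sign", Tao 2011, before (61)). [folklore] -/
theorem continuousOn_localisedDissipation {T : ℝ} {u : ℝ → ℝ³ → ℝ³}
    (hu : FluidPDE.IsSmoothSpaceTimeOn (Icc 0 T) u) (hT : 0 < T) {φ : ℝ³ → ℝ} (hφ : Continuous φ)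
    {K : Set ℝ³} (hK : IsCompact K) (hφK : support φ ⊆ K) :
    ContinuousOn (fun t => localisedDissipation φ (u t)) (Icc 0 T) := by
  unfold localisedDissipation
  refine FluidPDE.continuousOn_integral_of_support_subset (μ := volume) hK ?_ ?_
  · have h1 := hu.continuousOn_fderiv_slice (uniqueDiffOn_Icc hT)
    have h2 : ContinuousOn (fun z : ℝ × ℝ³ => φ z.2) (Icc 0 T ×ˢ univ) :=
      (hφ.comp continuous_snd).continuousOn
    exact h2.mul (continuous_frobeniusNormSq_clm.comp_continuousOn h1)
  · intro t _ x hx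
    have : φ x = 0 := by
      by_contra h
      exact hx (hφK (mem_support.2 h))
    simp [this]

/-- Along the cutoffs `θ_n = θ_{n+1, (n+1)/4}` the localised energies `E_{θ_n⁸}(v)` converge to
`½ ∫ |v|²` (dominated convergence; `θ_n⁸ ↑ 1`). [folklore] -/
theorem tendsto_localisedEnergy_quarter {v : ℝ³ → ℝ³} (hv : Continuous v)
    (hv2 : Integrable fun x => ‖v x‖ ^ 2) :
    Tendsto (fun n : ℕ =>
      localisedEnergy (fun x => taoCutoff ((n : ℝ) + 1) (((n : ℝ) + 1) / 4) x ^ 8) v)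
      atTop (𝓝 (2⁻¹ * ∫ x, ‖v x‖ ^ 2)) := by
  unfold localisedEnergy
  refine Tendsto.const_mul _ ?_
  refine tendsto_integral_of_dominated_convergence (fun x => ‖v x‖ ^ 2) ?_ hv2 ?_ ?_
  · intro n
    exact (((continuous_taoCutoff _ _).pow 8).mul (hv.norm.pow 2)).aestronglyMeasurable
  · intro n
    refine Eventually.of_forall fun x => ?_
    rw [Real.norm_eq_abs, abs_of_nonneg (mul_nonneg (taoCutoff_pow_nonneg _ _ _ _) (sq_nonneg _))]
    calc taoCutoff ((n : ℝ) + 1) (((n : ℝ) + 1) / 4) x ^ 8 * ‖v x‖ ^ 2 ≤ 1 * ‖v x‖ ^ 2 :=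
          mul_le_mul_of_nonneg_right (taoCutoff_pow_le_one _ _ _ _) (sq_nonneg _)
      _ = ‖v x‖ ^ 2 := one_mul _
  · refine Eventually.of_forall fun x => ?_
    apply tendsto_const_nhds.congr'
    have hev : ∀ᶠ n : ℕ in atTop, 2 * ‖x‖ ≤ (n : ℝ) :=
      tendsto_natCast_atTop_atTop.eventually_ge_atTop (2 * ‖x‖)
    filter_upwards [hev] with n hn
    have hpos : (0 : ℝ) < (n : ℝ) + 1 := by positivity
    rw [taoCutoff_quarter_eq_one x hpos (by linarith), one_pow, one_mul]

/-- **Assembly (Tao 2011, end of the proof of Lemma 8.1).** The localised energy inequality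
`tao2011_localisedEnergyInequality` implies the global energy inequality
`NS.tao_finite_energy_smooth_energy_bound` (with constant `C = 1`: the energy inequality
`sup_t ‖u(t)‖²_{L²} ≤ ‖u₀‖²_{L²}`, `ν ∫₀ᵀ ‖∇u‖²_{L²} ≤ ‖u₀‖²_{L²}`): apply the fact with `R = n + 1`,
`r = R/4`, so that the error `C(νA²/r² + A⁶/(ν³r⁴)) T → 0`, and pass to the limit `n → ∞` in
`E_{θ_n⁸}(u(t)) → ½‖u(t)‖²` (dominated convergence) and in
`∫₀ᵀ ∫ θ_n⁸ |∇u|² ↑ ∫₀ᵀ ∫ |∇u|²` (monotone convergence). [cite: Tao2011, Lemma 8.1] -/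
theorem tao_finite_energy_smooth_energy_bound_of_localisedEnergyInequality
    (h : tao2011_localisedEnergyInequality) : tao_finite_energy_smooth_energy_bound := by
  obtain ⟨C, hC0, hC⟩ := h
  refine ⟨1, ENNReal.one_lt_top, ?_⟩
  intro ν T hν hT u p hsol hE
  obtain ⟨A', hA', hEA⟩ := hE
  -- a real energy bound `A`
  set A : ℝ := Real.sqrt A'.toReal with hAdef
  have hA0 : 0 ≤ A := Real.sqrt_nonneg _
  have hA2 : ENNReal.ofReal (A ^ 2) = A' := by
    rw [hAdef, Real.sq_sqrt ENNReal.toReal_nonneg, ENNReal.ofReal_toReal hA'.ne]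
  have hEA' : ∀ t ∈ Icc 0 T, ∫⁻ x, ‖u t x‖ₑ ^ 2 ≤ ENNReal.ofReal (A ^ 2) := fun t ht =>
    hA2 ▸ hEA t ht
  -- slices
  have hcont : ∀ t ∈ Icc 0 T, Continuous (u t) := fun t ht =>
    (hsol.contDiff_velocity ht).continuous
  have hC1 : ∀ t ∈ Icc 0 T, ContDiff ℝ 1 (u t) := fun t ht =>
    (hsol.contDiff_velocity ht).of_le (by exact_mod_cast le_top)
  have hint : ∀ t ∈ Icc 0 T, Integrable fun x => ‖u t x‖ ^ 2 := fun t ht =>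
    integrable_sq_of_lintegral_enorm_sq_lt_top (hcont t ht)
      ((hEA' t ht).trans_lt ENNReal.ofReal_lt_top)
  have h0T : (0 : ℝ) ∈ Icc 0 T := ⟨le_rfl, hT.le⟩
  have hTT : T ∈ Icc 0 T := ⟨hT.le, le_rfl⟩
  -- the cutoff sequence
  have hpos : ∀ n : ℕ, (0 : ℝ) < (n : ℝ) + 1 := fun n => by positivity
  set φ : ℕ → ℝ³ → ℝ := fun n x => taoCutoff ((n : ℝ) + 1) (((n : ℝ) + 1) / 4) x ^ 8 with hφdef
  have hφ0 : ∀ n x, 0 ≤ φ n x := fun n x => taoCutoff_pow_nonneg _ _ _ _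
  have hφ1 : ∀ n x, φ n x ≤ 1 := fun n x => taoCutoff_pow_le_one _ _ _ _
  have hφc : ∀ n, Continuous (φ n) := fun n => (continuous_taoCutoff _ _).pow 8
  have hφK : ∀ n, support (φ n) ⊆ closedBall (0 : ℝ³) ((n : ℝ) + 1) := fun n =>
    support_taoCutoff_pow_subset (hpos n).le (by positivity) (by norm_num)
  have hφcs : ∀ n, HasCompactSupport (φ n) := fun n =>
    hasCompactSupport_taoCutoff_pow (hpos n).le (by positivity) (by norm_num)
  have hφmono : ∀ x, Monotone fun n => φ n x := by
    intro x m n hmn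
    simp only [hφdef]
    apply pow_le_pow_left₀ (taoCutoff_nonneg _ _ _)
    exact taoCutoff_quarter_mono x (hpos m) (by exact_mod_cast Nat.add_le_add_right hmn 1)
  have hφev : ∀ x, ∀ᶠ n : ℕ in atTop, φ n x = 1 := by
    intro x
    have hev : ∀ᶠ n : ℕ in atTop, 2 * ‖x‖ ≤ (n : ℝ) :=
      tendsto_natCast_atTop_atTop.eventually_ge_atTop (2 * ‖x‖)
    filter_upwards [hev] with n hn
    simp only [hφdef]
    rw [taoCutoff_quarter_eq_one x (hpos n) (by linarith), one_pow]
  -- the error terms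
  set err : ℕ → ℝ := fun n =>
    C * (ν * A ^ 2 / (((n : ℝ) + 1) / 4) ^ 2 + A ^ 6 / (ν ^ 3 * (((n : ℝ) + 1) / 4) ^ 4))
    with herrdef
  have herr0 : ∀ n, 0 ≤ err n := fun n => by positivity
  set K : ℝ := C * (16 * ν * A ^ 2 + 256 * A ^ 6 / ν ^ 3) with hKdef
  have herr_le : ∀ n, err n ≤ K * (1 / ((n : ℝ) + 1)) := by
    intro n
    have hm1 : (1 : ℝ) ≤ (n : ℝ) + 1 := by
      have : (0 : ℝ) ≤ n := Nat.cast_nonneg n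
      linarith
    have hm : (0 : ℝ) < (n : ℝ) + 1 := hpos n
    have e1 : ν * A ^ 2 / (((n : ℝ) + 1) / 4) ^ 2 = 16 * ν * A ^ 2 / ((n : ℝ) + 1) ^ 2 := by
      field_simp
      ring
    have e2 : A ^ 6 / (ν ^ 3 * (((n : ℝ) + 1) / 4) ^ 4) =
        256 * A ^ 6 / ν ^ 3 / ((n : ℝ) + 1) ^ 4 := by
      field_simp
      ring
    have i1 : 16 * ν * A ^ 2 / ((n : ℝ) + 1) ^ 2 ≤ 16 * ν * A ^ 2 / ((n : ℝ) + 1) :=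
      div_le_div_of_nonneg_left (by positivity) hm (le_self_pow₀ hm1 two_ne_zero)
    have i2 : 256 * A ^ 6 / ν ^ 3 / ((n : ℝ) + 1) ^ 4 ≤ 256 * A ^ 6 / ν ^ 3 / ((n : ℝ) + 1) :=
      div_le_div_of_nonneg_left (by positivity) hm (le_self_pow₀ hm1 (by norm_num))
    calc err n = C * (16 * ν * A ^ 2 / ((n : ℝ) + 1) ^ 2 + 256 * A ^ 6 / ν ^ 3 / ((n : ℝ) + 1) ^ 4) := by
          simp only [herrdef, e1, e2]
      _ ≤ C * (16 * ν * A ^ 2 / ((n : ℝ) + 1) + 256 * A ^ 6 / ν ^ 3 / ((n : ℝ) + 1)) := by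
          gcongr
      _ = K * (1 / ((n : ℝ) + 1)) := by
          simp only [hKdef]
          field_simp
  have herr : Tendsto err atTop (𝓝 0) := by
    refine squeeze_zero herr0 herr_le ?_
    simpa using (tendsto_one_div_add_atTop_nhds_zero_nat (𝕜 := ℝ)).const_mul K
  -- the fact along the sequence
  have key : ∀ n : ℕ, ∀ t ∈ Icc 0 T,
      localisedEnergy (φ n) (u t) + ν / 2 * ∫ s in Ioo 0 t, localisedDissipation (φ n) (u s) ≤
        2⁻¹ * (∫ x, ‖u 0 x‖ ^ 2) + err n * T := by
    intro n t ht
    have h1 := hC ν T hν hT u p hsol A hA0 hEA' ((n : ℝ) + 1) (((n : ℝ) + 1) / 4)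
      (by positivity) (by linarith [hpos n]) t ht
    have h2 : localisedEnergy (φ n) (u 0) ≤ 2⁻¹ * ∫ x, ‖u 0 x‖ ^ 2 :=
      localisedEnergy_le_of_le_one (hφ0 n) (hφ1 n) (hint 0 h0T)
    have h3 : err n * t ≤ err n * T := mul_le_mul_of_nonneg_left ht.2 (herr0 n)
    simp only [hφdef, herrdef] at h1 h2 h3 ⊢
    linarith
  -- nonnegativity of the two terms on the left
  have hLE0 : ∀ n t, 0 ≤ localisedEnergy (φ n) (u t) := fun n t =>
    localisedEnergy_nonneg (hφ0 n) _
  have hLD0 : ∀ n t, 0 ≤ ∫ s in Ioo 0 t, localisedDissipation (φ n) (u s) := fun n t =>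
    setIntegral_nonneg measurableSet_Ioo fun s _ => localisedDissipation_nonneg (hφ0 n) _
  -- limit of the right-hand side
  have hrhs : Tendsto (fun n => 2⁻¹ * (∫ x, ‖u 0 x‖ ^ 2) + err n * T) atTop
      (𝓝 (2⁻¹ * ∫ x, ‖u 0 x‖ ^ 2)) := by
    have := (herr.mul_const T).const_add (2⁻¹ * ∫ x, ‖u 0 x‖ ^ 2)
    simpa using this
  refine ⟨fun t ht => ?_, ?_⟩
  · -- (i) the energy bound at time `t`
    have hlim := tendsto_localisedEnergy_quarter (hcont t ht) (hint t ht)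
    have hle : 2⁻¹ * ∫ x, ‖u t x‖ ^ 2 ≤ 2⁻¹ * ∫ x, ‖u 0 x‖ ^ 2 :=
      le_of_tendsto_of_tendsto' hlim hrhs fun n =>
        (le_add_of_nonneg_right (mul_nonneg (by positivity) (hLD0 n t))).trans (key n t ht)
    have hle' : ∫ x, ‖u t x‖ ^ 2 ≤ ∫ x, ‖u 0 x‖ ^ 2 := by linarith
    rw [one_mul, ← ofReal_integral_norm_sq_eq_lintegral (hint t ht),
      ← ofReal_integral_norm_sq_eq_lintegral (hint 0 h0T)]
    exact ENNReal.ofReal_le_ofReal hle'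
  · -- (ii) the dissipation bound
    -- real bound for each `n`
    have hreal : ∀ n, ν * ∫ s in Ioo 0 T, localisedDissipation (φ n) (u s) ≤
        (∫ x, ‖u 0 x‖ ^ 2) + 2 * (err n * T) := by
      intro n
      have h1 := key n T hTT
      have h2 := hLE0 n T
      nlinarith
    -- continuity and integrability of the localised dissipation in time
    have hLDc : ∀ n, ContinuousOn (fun t => localisedDissipation (φ n) (u t)) (Icc 0 T) := fun n =>
      continuousOn_localisedDissipation hsol.smooth_velocity hT (hφc n) (isCompact_closedBall 0 _)
        (hφK n)
    have hLDi : ∀ n, IntegrableOn (fun t => localisedDissipation (φ n) (u t)) (Ioo 0 T) := fun n =>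
      ((hLDc n).integrableOn_Icc).mono_set Ioo_subset_Icc_self
    -- the inner lintegrals on `(0, T)`
    have hinner : ∀ n, ∀ t ∈ Ioo 0 T,
        ∫⁻ x, ENNReal.ofReal (φ n x * FluidPDE.frobeniusNormSq (fderiv ℝ (u t) x)) =
          ENNReal.ofReal (localisedDissipation (φ n) (u t)) := by
      intro n t ht
      have ht' : t ∈ Icc 0 T := Ioo_subset_Icc_self ht
      have hci : Continuous fun x => φ n x * FluidPDE.frobeniusNormSq (fderiv ℝ (u t) x) :=
        (hφc n).mul (continuous_frobeniusNormSq_clm.comp ((hC1 t ht').continuous_fderiv one_ne_zero))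
      have hii : Integrable fun x => φ n x * FluidPDE.frobeniusNormSq (fderiv ℝ (u t) x) :=
        hci.integrable_of_hasCompactSupport (hφcs n).mul_right
      rw [localisedDissipation, ofReal_integral_eq_lintegral_ofReal hii
        (ae_of_all _ fun x => mul_nonneg (hφ0 n x) (FluidPDE.frobeniusNormSq_nonneg _))]
    -- `a n`: the localised space-time dissipation as a lintegral
    have ha : ∀ n, ∫⁻ t in Ioo 0 T, ∫⁻ x,
        ENNReal.ofReal (φ n x * FluidPDE.frobeniusNormSq (fderiv ℝ (u t) x)) =
          ENNReal.ofReal (∫ t in Ioo 0 T, localisedDissipation (φ n) (u t)) := by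
      intro n
      rw [ofReal_integral_eq_lintegral_ofReal (hLDi n)
        (ae_of_all _ fun t => localisedDissipation_nonneg (hφ0 n) (u t))]
      refine setLIntegral_congr_fun measurableSet_Ioo ?_
      exact fun t ht => hinner n t ht
    -- measurability in `t` of the inner lintegrals
    have hameas : ∀ n, AEMeasurable (fun t => ∫⁻ x,
        ENNReal.ofReal (φ n x * FluidPDE.frobeniusNormSq (fderiv ℝ (u t) x)))
        (volume.restrict (Ioo 0 T)) := by
      intro n
      have h1 : AEMeasurable (fun t => ENNReal.ofReal (localisedDissipation (φ n) (u t)))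
          (volume.restrict (Ioo 0 T)) :=
        ENNReal.measurable_ofReal.comp_aemeasurable
          (((hLDc n).mono Ioo_subset_Icc_self).aemeasurable measurableSet_Ioo)
      refine h1.congr ?_
      filter_upwards [ae_restrict_mem measurableSet_Ioo] with t ht
      exact (hinner n t ht).symm
    -- monotone convergence in `x`, then in `t`
    have hsupx : ∀ t ∈ Ioo 0 T, ∫⁻ x, ENNReal.ofReal (FluidPDE.frobeniusNormSq (fderiv ℝ (u t) x)) =
        ⨆ n, ∫⁻ x, ENNReal.ofReal (φ n x * FluidPDE.frobeniusNormSq (fderiv ℝ (u t) x)) := by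
      intro t ht
      have ht' : t ∈ Icc 0 T := Ioo_subset_Icc_self ht
      rw [← lintegral_iSup']
      · refine lintegral_congr fun x => ?_
        apply le_antisymm
        · obtain ⟨N, hN⟩ := (hφev x).exists
          refine le_iSup_of_le N ?_
          rw [hN, one_mul]
        · exact iSup_le fun n => ENNReal.ofReal_le_ofReal
            (mul_le_of_le_one_left (FluidPDE.frobeniusNormSq_nonneg _) (hφ1 n x))
      · intro n
        exact ((hφc n).mul (continuous_frobeniusNormSq_clm.comp
          ((hC1 t ht').continuous_fderiv one_ne_zero))).measurable.ennreal_ofReal.aemeasurable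
      · exact ae_of_all _ fun x m n hmn => ENNReal.ofReal_le_ofReal
          (mul_le_mul_of_nonneg_right (hφmono x hmn) (FluidPDE.frobeniusNormSq_nonneg _))
    have hsup : ∫⁻ t in Ioo 0 T, ∫⁻ x, ENNReal.ofReal (FluidPDE.frobeniusNormSq (fderiv ℝ (u t) x)) =
        ⨆ n, ∫⁻ t in Ioo 0 T, ∫⁻ x,
          ENNReal.ofReal (φ n x * FluidPDE.frobeniusNormSq (fderiv ℝ (u t) x)) := by
      rw [← lintegral_iSup' hameas]
      · exact setLIntegral_congr_fun measurableSet_Ioo hsupx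
      · exact ae_of_all _ fun t m n hmn => lintegral_mono fun x => ENNReal.ofReal_le_ofReal
          (mul_le_mul_of_nonneg_right (hφmono x hmn) (FluidPDE.frobeniusNormSq_nonneg _))
    -- monotonicity of `a n`
    have hamono : Monotone fun n => ∫⁻ t in Ioo 0 T, ∫⁻ x,
        ENNReal.ofReal (φ n x * FluidPDE.frobeniusNormSq (fderiv ℝ (u t) x)) :=
      fun m n hmn => lintegral_mono fun t => lintegral_mono fun x => ENNReal.ofReal_le_ofReal
        (mul_le_mul_of_nonneg_right (hφmono x hmn) (FluidPDE.frobeniusNormSq_nonneg _))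
    -- limit of the real bounds
    have hb : Tendsto (fun n => ENNReal.ofReal ((∫ x, ‖u 0 x‖ ^ 2) + 2 * (err n * T))) atTop
        (𝓝 (∫⁻ x, ‖u 0 x‖ₑ ^ 2)) := by
      rw [← ofReal_integral_norm_sq_eq_lintegral (hint 0 h0T)]
      refine ENNReal.tendsto_ofReal ?_
      have := ((herr.mul_const T).const_mul 2).const_add (∫ x, ‖u 0 x‖ ^ 2)
      simpa using this
    -- conclusion
    rw [hsup, ENNReal.mul_iSup, one_mul]
    refine iSup_le fun n => ?_
    refine ge_of_tendsto hb (eventually_atTop.2 ⟨n, fun m hm => ?_⟩)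
    calc ENNReal.ofReal ν * ∫⁻ t in Ioo 0 T, ∫⁻ x,
          ENNReal.ofReal (φ n x * FluidPDE.frobeniusNormSq (fderiv ℝ (u t) x))
        ≤ ENNReal.ofReal ν * ∫⁻ t in Ioo 0 T, ∫⁻ x,
          ENNReal.ofReal (φ m x * FluidPDE.frobeniusNormSq (fderiv ℝ (u t) x)) :=
          mul_le_mul' le_rfl (hamono hm)
      _ = ENNReal.ofReal (ν * ∫ t in Ioo 0 T, localisedDissipation (φ m) (u t)) := by
          rw [ha m, ENNReal.ofReal_mul hν.le]
      _ ≤ ENNReal.ofReal ((∫ x, ‖u 0 x‖ ^ 2) + 2 * (err m * T)) :=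
          ENNReal.ofReal_le_ofReal (hreal m)

end Assembly

end Literature.Analysis.FluidPDE
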